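import Summits.NavierStokesRegularity.NavierStokesRegularity.Theses.AxisymmetricExtremality
import Literature.Analysis.FluidPDE.AxisymmetricTypeIBounded
import Literature.Analysis.FluidPDE.SuitableWeakRescaling
import Literature.Analysis.FluidPDE.ClassicalSuitable
import Literature.Analysis.FluidPDE.SereginSverakBlowupSelection
import Literature.Analysis.FluidPDE.SereginSverakPressureDecayBalls
import Literature.Analysis.FluidPDE.LeiZhang2011ZoomIn
import HarnessLib

/-!
# Crux `AxisymmetricKatoGlobal` (stmt-NavierStokesRegularity-15453), line `registered`, stub 2c'
# `stub_axisBounded_of_localEnergy_origin`: the local log³-swirl criterion at axis points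

Support file (theorems only, `--supports stmt-NavierStokesRegularity-15453`).

The stub is a pure transfer statement.  Its first hypothesis is the local regularity criterion
of the sibling stub 2a (G. Seregin, J. Math. Fluid Mech. 24 (2022) = arXiv:2201.00153, §2: an
axisymmetric suitable weak solution `(v, q)` of the unit-viscosity system in the unit cylinder
`Q = 𝒞 × ]-1, 0[` (`SereginSverak2009.parCyl 0 1`) with `v ∈ L_{2,∞}(Q)`, `∇v ∈ L₂(Q)`,
`q ∈ L_{3/2}(Q)` and the swirl bound `|Γ| ≤ C₁ / ln³(e/|x'|)` is regular at the origin).  GIVEN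
it, a suitable weak solution `(u, p)` (viscosity `ν > 0`) on the open strip `(0, T) × ℝ³`, `u`
smooth with axisymmetric slices, `p` with axisymmetric slices, local energy classes reaching the
final time on every `(t₁, T) × B_ρ(0)`, swirl with the logarithmic axis modulus
`|Γ(t, x)| ≤ C / |log |x'||³` (`|x'| ≤ δ₀ < 1`, `t₀ ≤ t < T`), is bounded near `(T, x₀)` for every
`x₀` ON the axis (`IsBoundedNearTop u T x₀`).

Proof: with a scale `λ > 0`, `λ ≤ δ₀`, `λ ≤ e⁻¹`, `λ²/ν < T - t₀` (`exists_scale`) put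
`Φ(s, y) = (T + (λ²/ν) s, x₀ + λ y)`, `v = (λ/ν) u ∘ Φ`, `q = (λ/ν)² p ∘ Φ`
(`IsSuitableWeakSolutionOn.stRescale`: viscosity `(λ/ν) ν / λ = 1`; `.of_le` to the unit cylinder,
which `Φ` maps into `(T - λ²/ν, T) × B(x₀, 2λ) ⊆ (t₀, T) × B(0, ρ)`); the three classes on the
unit cylinder come from the hypothesised ones by the change of variables
(`ae_sliced_setLIntegral_ball_stRescale`, `setLIntegral_frobeniusNormSq_stRescale` for the weak
gradient `(λ²/ν) ∇u ∘ Φ` of `hasWeakSpatialGradientOn_of_contDiffOn` / `.stRescale`,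
`setLIntegral_enorm_rpow_stRescale`); `x₀ = b e₃` is fixed by the (linear) rotations about the
axis, so the rescaled slices stay axisymmetric (`SereginSverak2009.isAxisymmetric_rescale`); the
swirl is scale invariant, `Γ_v(s, y) = ν⁻¹ Γ_u(Φ(s, y))` (`swirl_smul_comp_eZ_smul`), and for
`0 < r = |y'| < 1`, `λ ≤ e⁻¹`: `|log (λ r)| = -log λ - log r ≥ 1 - log r = log (e/r) > 0`, so
`|Γ_v| ≤ (max C 0 / ν) / log³(e/r)`.  The criterion gives `v ∈ L^∞(Q(r)) ⊆ L^∞(Q_r(0))`, which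
is transported back along the measure-scaling bijection `Φ` to an a.e. bound of `u` on a
backward neighbourhood of `(T, x₀)`, an everywhere bound by continuity
(`isBoundedNearTop_of_eLpNorm_rescaled_lt_top`).  References: G. Seregin, J. Math. Fluid
Mech. 24 (2022), arXiv:2201.00153, §2 [Seregin2022]; G. Seregin, V. Šverák, Comm. PDE 34 (2009)
= arXiv:0804.1803, §4 (the axis-centred rescaling before (p3)) [SereginSverak2009];
L. Caffarelli, R. Kohn, L. Nirenberg, Comm. Pure Appl. Math. 35 (1982), §2 (scaling)
[CaffarelliKohnNirenberg1982].
-/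

noncomputable section

-- the summit and its single sub-problem share the name (CONVENTIONS §1), as in every Theorems file
set_option linter.dupNamespace false

open Set MeasureTheory Filter Topology Function Metric Module Literature.Analysis.FluidPDE
open scoped ENNReal NNReal

namespace Summit.NavierStokesRegularity.NavierStokesRegularity.Theorems.AxisymmetricKatoGlobal.Registered

/-- Local notation for physical space `ℝ³`. -/
local notation "ℝ³" => EuclideanSpace ℝ (Fin 3)

/-! ### Elementary inputs: the scale, the logarithms, the unit cylinder, axis points -/

/-- **The scale of the zoom**: for `ν > 0`, `t₀ < T`, `δ₀ > 0` there is `λ > 0` with `λ ≤ δ₀`,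
`λ ≤ e⁻¹`, `λ²/ν < T - t₀` (half of `min (δ₀, e⁻¹, ν (T - t₀)) < 1`). [folklore] -/
theorem exists_scale {ν T t₀ δ₀ : ℝ} (hν : 0 < ν) (ht₀ : t₀ < T) (hδ₀ : 0 < δ₀) :
    ∃ l : ℝ, 0 < l ∧ l ≤ δ₀ ∧ l ≤ Real.exp (-1) ∧ l ^ 2 / ν < T - t₀ := by
  set m : ℝ := min (min δ₀ (Real.exp (-1))) (ν * (T - t₀)) with hm
  have hm0 : 0 < m := lt_min (lt_min hδ₀ (Real.exp_pos _)) (mul_pos hν (by linarith))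
  have hmδ : m ≤ δ₀ := (min_le_left _ _).trans (min_le_left _ _)
  have hme : m ≤ Real.exp (-1) := (min_le_left _ _).trans (min_le_right _ _)
  have hmν : m ≤ ν * (T - t₀) := min_le_right _ _
  have he1 : Real.exp (-1) < 1 := Real.exp_lt_one_iff.2 (by norm_num)
  refine ⟨m / 2, by positivity, by linarith, by linarith, ?_⟩
  rw [div_lt_iff₀ hν]
  nlinarith [mul_pos hm0 (show 0 < 2 - m by linarith)]

/-- **The logarithms.** For `0 < λ ≤ e⁻¹` and `0 < r < 1`:
`0 < log (e / r) = 1 - log r ≤ -log λ - log r = |log (λ r)|`. [folklore] -/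
theorem log_exp_one_div_le_abs_log_mul {l r : ℝ} (hl : 0 < l) (hle : l ≤ Real.exp (-1))
    (hr : 0 < r) (hr1 : r < 1) :
    0 < Real.log (Real.exp 1 / r) ∧ Real.log (Real.exp 1 / r) ≤ |Real.log (l * r)| := by
  have hlogr : Real.log r < 0 := Real.log_neg hr hr1
  have hlogl : Real.log l ≤ -1 := by simpa using Real.log_le_log hl hle
  have h1 : Real.log (Real.exp 1 / r) = 1 - Real.log r := by
    rw [Real.log_div (Real.exp_pos 1).ne' hr.ne', Real.log_exp]
  have h2 : Real.log (l * r) = Real.log l + Real.log r := Real.log_mul hl.ne' hr.ne'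
  refine ⟨by rw [h1]; linarith, ?_⟩
  rw [h1, h2, abs_of_neg (by linarith)]
  linarith

/-- The unit coordinate cylinder `𝒞 = {|y'| < 1, |y₃| < 1}` lies in the ball `B(0, 2)`
(`‖y‖ ≤ |y'| + |y₃|`). [folklore] -/
theorem spaceCyl_zero_one_subset_ball : SereginSverak2009.spaceCyl (0 : ℝ³) 1 ⊆ ball 0 2 := by
  intro y hy
  rw [SereginSverak2009.mem_spaceCyl] at hy
  obtain ⟨h1, h2⟩ := hy
  simp only [sub_zero, PiLp.zero_apply] at h1 h2
  rw [mem_ball, dist_zero_right]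
  linarith [SereginSverak2009.norm_le_cylRadius_add_abs y]

/-- **The zoom maps the unit cylinder into a small backward box at `(T, x₀)`**:
`Q(0, 1) ⊆ Φ⁻¹((T - β, T) × B(x₀, 2γ))` for `Φ(s, y) = (T + β s, x₀ + γ y)`. [folklore] -/
theorem parCyl_zero_one_subset_preimage_stAffine {β γ : ℝ} (hβ : 0 < β) (hγ : 0 < γ) (T : ℝ)
    (x₀ : ℝ³) :
    SereginSverak2009.parCyl 0 1 ⊆ stAffine β γ T x₀ ⁻¹' (Ioo (T - β) T ×ˢ ball x₀ (2 * γ)) := by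
  intro z hz
  rw [SereginSverak2009.mem_parCyl_zero] at hz
  obtain ⟨hs, hr, h3⟩ := hz
  have hs' : z.1 ∈ Ioo (-1 : ℝ) 0 := by simpa using hs
  have hn : ‖z.2‖ < 2 := by linarith [SereginSverak2009.norm_le_cylRadius_add_abs z.2]
  rw [mem_preimage]
  refine mem_prod.2 ⟨?_, ?_⟩
  · rw [stAffine_fst]
    exact ⟨by nlinarith [hs'.1], by nlinarith [hs'.2]⟩
  · rw [stAffine_snd, mem_ball, dist_eq_norm, add_sub_cancel_left, norm_smul,
      Real.norm_of_nonneg hγ.le]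
    nlinarith

/-- A point of the axis (`cylRadius x₀ = 0`) is `x₀ = x₀₃ e₃`. [folklore] -/
theorem eq_smul_eZ_of_cylRadius_eq_zero {x₀ : ℝ³} (hx₀ : cylRadius x₀ = 0) : x₀ = x₀ 2 • eZ := by
  have h := SereginSverak2009.horiz_add_smul_eZ x₀
  have h0 : SereginSverak2009.horiz x₀ = 0 := by
    rw [← norm_eq_zero, SereginSverak2009.norm_horiz]
    exact hx₀
  rw [h0, zero_add] at h
  exact h.symm

/-! ### From the essential bound of the rescaled solution back to `u` -/

/-- **Transport of an essential bound near the vertex** (the argument of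
`AxisymmetricL3Hyp.isBoundedNearTop_of_eLpNorm_rescaled_lt_top`, its structure hypothesis replaced
by continuity of `u` on the open strip): if `α u(T + β s, x₀ + R y)` is essentially bounded on
`Q_r(0)`, then `u` is bounded on a backward neighbourhood of `(T, x₀)` (transport along the
measure-scaling bijection `Φ`, then a.e. to everywhere by continuity below `T`). [folklore] -/
theorem isBoundedNearTop_of_eLpNorm_rescaled_lt_top {T : ℝ} (hT : 0 < T) {u : ℝ → ℝ³ → ℝ³}
    (hcont : ContinuousOn (uncurry u) (Ioo 0 T ×ˢ univ)) (x₀ : ℝ³) {α β R r : ℝ} (hα : 0 < α)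
    (hβ : 0 < β) (hR : 0 < R) (hr : 0 < r)
    (hbd : eLpNorm (uncurry (α • stPull β R T x₀ u)) ∞
      (volume.restrict (parabolicCylinder r (0 : ℝ × ℝ³))) < ∞) :
    IsBoundedNearTop u T x₀ := by
  -- an a.e. bound for `u ∘ Φ` on `Q_r(0)`
  set S' : Set (ℝ × ℝ³) := parabolicCylinder r 0 with hS'
  set M : ℝ := (eLpNorm (uncurry (α • stPull β R T x₀ u)) ∞ (volume.restrict S')).toReal with hM
  have haeS' : ∀ᵐ w ∂(volume.restrict S'),
      ‖u (stAffine β R T x₀ w).1 (stAffine β R T x₀ w).2‖ ≤ M / α := by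
    have h1 := ae_le_eLpNormEssSup (μ := volume.restrict S') (f := uncurry (α • stPull β R T x₀ u))
    filter_upwards [h1] with w hw
    rw [← eLpNorm_exponent_top] at hw
    have hw' : ‖uncurry (α • stPull β R T x₀ u) w‖ ≤ M := by
      rw [hM, ← ENNReal.ofReal_le_iff_le_toReal hbd.ne, ofReal_norm]
      exact hw
    rw [le_div_iff₀' hα]
    have e : uncurry (α • stPull β R T x₀ u) w =
        α • u (stAffine β R T x₀ w).1 (stAffine β R T x₀ w).2 := by
      obtain ⟨s, y⟩ := w; rfl
    rw [e, norm_smul, Real.norm_of_nonneg hα.le] at hw'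
    exact hw'
  -- transported to the image `Φ(Q_r(0))`
  have haeP : ∀ᵐ z ∂(volume.restrict (stAffine β R T x₀ '' S')),
      ‖u z.1 z.2‖ ≤ M / α := by
    refine ae_restrict_of_ae_restrict_preimage_stAffine hβ hR T x₀
      (P := fun z : ℝ × ℝ³ => ‖u z.1 z.2‖ ≤ M / α) ?_
    rw [preimage_image_eq _ (injective_stAffine hβ.ne' hR.ne' T x₀)]
    exact haeS'
  -- a backward neighbourhood of `(T, x₀)` inside `Φ(Q_r(0))` and inside the slab
  set r' : ℝ := min (r * min (Real.sqrt β) R) (Real.sqrt T / 2) with hr'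
  have hmin : 0 < min (Real.sqrt β) R := lt_min (Real.sqrt_pos.2 hβ) hR
  have hr'pos : 0 < r' := lt_min (mul_pos hr hmin) (by positivity)
  have hr'le : r' ≤ r * min (Real.sqrt β) R := min_le_left _ _
  have hr'T : r' ^ 2 ≤ T / 4 := by
    have h2 := pow_le_pow_left₀ hr'pos.le (min_le_right _ _ : r' ≤ Real.sqrt T / 2) 2
    rw [div_pow, Real.sq_sqrt hT.le] at h2; linarith
  set U : Set (ℝ × ℝ³) := Ioo (T - r' ^ 2) T ×ˢ ball x₀ r' with hU
  have hUsub : U ⊆ stAffine β R T x₀ '' S' := by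
    rintro ⟨t, x⟩ ⟨ht, hx⟩
    refine ⟨((t - T) / β, R⁻¹ • (x - x₀)), ?_, ?_⟩
    · rw [hS', mem_parabolicCylinder]
      have hr'β : r' ^ 2 ≤ β * r ^ 2 := by
        have h1 : r' ≤ r * Real.sqrt β :=
          hr'le.trans (mul_le_mul_of_nonneg_left (min_le_left _ _) hr.le)
        have h2 : r' ^ 2 ≤ (r * Real.sqrt β) ^ 2 := pow_le_pow_left₀ hr'pos.le h1 2
        rw [mul_pow, Real.sq_sqrt hβ.le] at h2
        linarith
      have hr'R : r' ≤ R * r := by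
        have h1 : r' ≤ r * R := hr'le.trans (mul_le_mul_of_nonneg_left (min_le_right _ _) hr.le)
        linarith
      refine ⟨⟨?_, ?_⟩, ?_⟩
      · show (0 : ℝ) - r ^ 2 < (t - T) / β
        rw [lt_div_iff₀ hβ]; nlinarith [ht.1]
      · show (t - T) / β < 0
        exact div_neg_of_neg_of_pos (by linarith [ht.2]) hβ
      · show dist (R⁻¹ • (x - x₀)) 0 < r
        rw [dist_zero_right, norm_smul, Real.norm_of_nonneg (inv_nonneg.2 hR.le),
          inv_mul_lt_iff₀ hR]
        rw [mem_ball, dist_eq_norm] at hx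
        linarith
    · rw [stAffine_apply]
      ext1
      · show T + β * ((t - T) / β) = t
        field_simp; ring
      · show x₀ + R • R⁻¹ • (x - x₀) = x
        rw [smul_smul, mul_inv_cancel₀ hR.ne', one_smul, add_sub_cancel]
  -- everywhere bound on `U` by continuity
  have hUopen : IsOpen U := isOpen_Ioo.prod isOpen_ball
  have hUslab : U ⊆ Ioo 0 T ×ˢ (univ : Set ℝ³) := fun z hz =>
    ⟨⟨by nlinarith [hz.1.1], hz.1.2⟩, mem_univ _⟩
  have hcontU : ContinuousOn (fun z : ℝ × ℝ³ => u z.1 z.2) U := hcont.mono hUslab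
  have hbound := SereginSverak2009.forall_le_of_ae_le_of_continuousOn hUopen hcontU.norm
    continuousOn_const (ae_restrict_of_ae_restrict_of_subset hUsub haeP)
  exact ⟨r', hr'pos, M / α, fun t ht x hx => hbound (t, x) ⟨ht, hx⟩⟩

/-- **Stub 2c' `stub_axisBounded_of_localEnergy_origin` of the line `registered` of the crux
`AxisymmetricKatoGlobal`**: transfer of the local log³-swirl criterion (stub 2a, Seregin 2022,
arXiv:2201.00153, §2) to axis points of a suitable weak solution on the strip `(0, T) × ℝ³` whose
local energy classes reach the final time — translation of `(T, b e₃)` to the origin, parabolic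
rescaling (`exists_scale`), viscosity normalisation, change of variables for the three classes,
axisymmetry and scale invariance of the swirl with `|log (λ r)| ≥ log (e/r)`, transport of the
essential bound back to `u`; see the module docstring.
[cite: SereginSverak2009, §4 (the rescaling before (p3), arXiv p. 11)] -/
theorem stub_axisBounded_of_localEnergy_origin :
    (∀ (v : ℝ → ℝ³ → ℝ³) (q : ℝ → ℝ³ → ℝ),
      IsSuitableWeakSolutionOn (SereginSverak2009.parCylOpens 0 1) 1 0 v q →
      (∃ C : ℝ≥0, ∀ᵐ t ∂(volume.restrict (Ioo (-1 : ℝ) 0)),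
          ∫⁻ x in SereginSverak2009.spaceCyl 0 1, ‖v t x‖ₑ ^ 2 ≤ C) →
      (∃ G : ℝ → ℝ³ → ℝ³ →L[ℝ] ℝ³,
          HasWeakSpatialGradientOn (SereginSverak2009.parCylOpens 0 1) v G ∧
          ∫⁻ z in SereginSverak2009.parCyl 0 1, ENNReal.ofReal (frobeniusNormSq (G z.1 z.2)) < ∞) →
      (∫⁻ z in SereginSverak2009.parCyl 0 1, ‖q z.1 z.2‖ₑ ^ (3 / 2 : ℝ) < ∞) →
      (∀ t ∈ Ioo (-1 : ℝ) 0, IsAxisymmetric (v t)) →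
      (∀ t ∈ Ioo (-1 : ℝ) 0, IsAxisymmetricScalar (q t)) →
      (∃ C₁ : ℝ, ∀ t ∈ Ioo (-1 : ℝ) 0, ∀ x ∈ SereginSverak2009.spaceCyl 0 1, 0 < cylRadius x →
          |swirl (v t) x| ≤ C₁ / Real.log (Real.exp 1 / cylRadius x) ^ 3) →
      SereginSverak2009.IsRegularAtOrigin v) →
    ∀ ν : ℝ, 0 < ν → ∀ T : ℝ, 0 < T → ∀ (u : ℝ → ℝ³ → ℝ³) (p : ℝ → ℝ³ → ℝ),
      ContDiffOn ℝ (⊤ : ℕ∞) (uncurry u) (Ioo 0 T ×ˢ univ) →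
      (∀ t ∈ Ioo 0 T, IsAxisymmetric (u t)) →
      (∀ t ∈ Ioo 0 T, IsAxisymmetricScalar (p t)) →
      IsSuitableWeakSolutionOn (slab ℝ³ (Ioo 0 T) isOpen_Ioo) ν 0 u p →
      (∀ t₁ ∈ Ioo 0 T, ∀ ρ : ℝ, 0 < ρ →
          (∃ C : ℝ≥0, ∀ t ∈ Ioo t₁ T, ∫⁻ x in ball (0 : ℝ³) ρ, ‖u t x‖ₑ ^ 2 ≤ C) ∧
          (∫⁻ z in Ioo t₁ T ×ˢ ball (0 : ℝ³) ρ,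
              ENNReal.ofReal (frobeniusNormSq (fderiv ℝ (u z.1) z.2)) < ∞) ∧
          (∫⁻ z in Ioo t₁ T ×ˢ ball (0 : ℝ³) ρ, ‖p z.1 z.2‖ₑ ^ (3 / 2 : ℝ) < ∞)) →
      (∃ t₀ ∈ Ioo 0 T, ∃ C δ₀ : ℝ, 0 < δ₀ ∧ δ₀ < 1 ∧
          ∀ t ∈ Ico t₀ T, ∀ x : ℝ³, cylRadius x ≤ δ₀ →
            |swirl (u t) x| ≤ C / |Real.log (cylRadius x)| ^ 3) →
      ∀ x₀ : ℝ³, cylRadius x₀ = 0 → IsBoundedNearTop u T x₀ := by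
  intro hloc ν hν T hT u p hsm hax hpax hsw hcls hmod x₀ hx₀
  -- the axis point is `b e₃`
  obtain ⟨b, rfl⟩ : ∃ b : ℝ, x₀ = b • eZ := ⟨x₀ 2, eq_smul_eZ_of_cylRadius_eq_zero hx₀⟩
  -- the modulus and the scale
  obtain ⟨t₀, ht₀, C, δ₀, hδ₀, hδ₁, hΓ⟩ := hmod
  obtain ⟨l, hl, hlδ, hle, hlT⟩ := exists_scale hν ht₀.2 hδ₀
  set α : ℝ := l / ν with hαdef
  set β : ℝ := l ^ 2 / ν with hβdef
  have hα : 0 < α := by positivity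
  have hβ : 0 < β := by positivity
  have hβeq : β = α * l := by rw [hβdef, hαdef]; field_simp
  have hβt₀ : t₀ < T - β := by rw [hβdef]; linarith
  -- the rescaled pair
  set v : ℝ → ℝ³ → ℝ³ := α • stPull β l T (b • eZ) u with hv
  set q : ℝ → ℝ³ → ℝ := α ^ 2 • stPull β l T (b • eZ) p with hq
  have hvs : ∀ s, v s = fun y => α • u (T + β * s) (b • eZ + l • y) := fun s => by
    funext y; rfl
  -- the rescaled times lie in `(T - β, T) ⊆ (t₀, T) ⊆ (0, T)`
  have htime : ∀ s ∈ Ioo (-1 : ℝ) 0, T + β * s ∈ Ioo t₀ T := fun s hs =>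
    ⟨by nlinarith [hs.1], by nlinarith [hs.2]⟩
  have htime0 : ∀ s ∈ Ioo (-1 : ℝ) 0, T + β * s ∈ Ioo 0 T := fun s hs =>
    ⟨ht₀.1.trans (htime s hs).1, (htime s hs).2⟩
  -- (0) the unit cylinder is mapped into the strip, and into the box `(T - β, T) × B(x₀, 2λ)`
  have hparsub := parCyl_zero_one_subset_preimage_stAffine hβ hl T (b • eZ)
  have hdom : SereginSverak2009.parCylOpens 0 1 ≤
      stPreimage β l T (b • eZ) (slab ℝ³ (Ioo 0 T) isOpen_Ioo) := fun z hz => by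
    have h := (mem_prod.1 (hparsub hz)).1
    rw [mem_stPreimage, mem_slab]
    exact ⟨by linarith [h.1, ht₀.1], h.2⟩
  -- the physical box lies in `(t₀, T) × B(0, ρ)`, where the classes are hypothesised
  set ρ : ℝ := ‖(b • eZ : ℝ³)‖ + 2 * l with hρ
  have hρpos : 0 < ρ := by positivity
  have hballρ : ball (b • eZ : ℝ³) (2 * l) ⊆ ball 0 ρ := by
    intro x hx
    rw [mem_ball, dist_eq_norm] at hx
    rw [mem_ball, dist_zero_right, hρ]
    linarith [norm_le_norm_add_norm_sub' x (b • eZ : ℝ³)]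
  have hPBsub : Ioo (T - β) T ×ˢ ball (b • eZ : ℝ³) (2 * l) ⊆ Ioo t₀ T ×ˢ ball 0 ρ :=
    prod_mono (Ioo_subset_Ioo_left hβt₀.le) hballρ
  obtain ⟨⟨CA, hCA⟩, hgradfin, hpresfin⟩ := hcls t₀ ht₀ ρ hρpos
  -- (1) the rescaled pair is a suitable weak solution of the unit-viscosity system on `Q(0, 1)`
  have hsuitv : IsSuitableWeakSolutionOn (SereginSverak2009.parCylOpens 0 1) 1 0 v q := by
    have h0 := hsw.stRescale hα hl hβeq T (b • eZ)
    have hvisc : α * ν / l = 1 := by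
      rw [hαdef, div_mul_cancel₀ l hν.ne', div_self hl.ne']
    have hforce : ((α ^ 2 * l) • stPull β l T (b • eZ) (0 : ℝ → ℝ³ → ℝ³)) = 0 := by
      funext s y; simp [stPull]
    rw [hvisc, hforce] at h0
    exact h0.of_le hdom
  -- (2) `v ∈ L_{2,∞}(Q)`
  have hA : ∃ C : ℝ≥0, ∀ᵐ s ∂(volume.restrict (Ioo (-1 : ℝ) 0)),
      ∫⁻ y in SereginSverak2009.spaceCyl 0 1, ‖v s y‖ₑ ^ 2 ≤ C := by
    have hphys : ∀ᵐ t ∂(volume.restrict (Ioo (T + β * (-1)) (T + β * 0))),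
        ∫⁻ x in ball (b • eZ : ℝ³) (2 * l), ‖u t x‖ₑ ^ 2 ≤ (CA : ℝ≥0∞) := by
      refine (ae_restrict_mem measurableSet_Ioo).mono fun t ht => ?_
      exact (lintegral_mono_set hballρ).trans (hCA t ⟨by linarith [ht.1], by linarith [ht.2]⟩)
    have h2 := ae_sliced_setLIntegral_ball_stRescale hβ hl T (b • eZ) (b • eZ) (2 * l) (-1) 0
      (fun t x => ‖u t x‖ₑ ^ 2) hphys
    have h2l : 2 * l / l = 2 := by rw [mul_div_assoc, div_self hl.ne', mul_one]
    rw [finrank_euclideanSpace_fin, sub_self, smul_zero, h2l] at h2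
    set C₁ : ℝ≥0∞ := ‖α‖ₑ ^ 2 * (ENNReal.ofReal (l ^ 3)⁻¹ * CA) with hC₁
    have hC₁top : C₁ ≠ ∞ :=
      ENNReal.mul_ne_top (by simp) (ENNReal.mul_ne_top ENNReal.ofReal_ne_top ENNReal.coe_ne_top)
    refine ⟨C₁.toNNReal, ?_⟩
    rw [ENNReal.coe_toNNReal hC₁top]
    filter_upwards [h2] with s hs
    have e : ∀ y : ℝ³, ‖v s y‖ₑ ^ 2 = ‖α‖ₑ ^ 2 * ‖u (T + β * s) (b • eZ + l • y)‖ₑ ^ 2 := by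
      intro y
      rw [hvs s]
      simp only [enorm_smul, mul_pow]
    simp only [e]
    rw [lintegral_const_mul' _ _ (by simp)]
    exact mul_le_mul' le_rfl ((lintegral_mono_set spaceCyl_zero_one_subset_ball).trans hs)
  -- (3) `∇v = (α λ) ∇u ∘ Φ ∈ L₂(Q)`
  set G : ℝ → ℝ³ → ℝ³ →L[ℝ] ℝ³ :=
    (α * l) • stPull β l T (b • eZ) (fun t x => fderiv ℝ (u t) x) with hG
  have hGu : HasWeakSpatialGradientOn (slab ℝ³ (Ioo 0 T) isOpen_Ioo) u
      fun t x => fderiv ℝ (u t) x :=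
    hasWeakSpatialGradientOn_of_contDiffOn isOpen_Ioo (by rw [coe_slab]) (hsm.of_le (by norm_cast))
  have hGv : HasWeakSpatialGradientOn (SereginSverak2009.parCylOpens 0 1) v G :=
    (hGu.stRescale α hβ hl T (b • eZ)).mono hdom
  have hGfin : ∫⁻ z in SereginSverak2009.parCyl 0 1, ENNReal.ofReal (frobeniusNormSq (G z.1 z.2)) < ∞ := by
    refine lt_of_le_of_lt (lintegral_mono_set hparsub) ?_
    rw [hG, setLIntegral_frobeniusNormSq_stRescale hβ hl T (b • eZ) (α * l), finrank_euclideanSpace_fin]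
    refine ENNReal.mul_lt_top (ENNReal.mul_lt_top ENNReal.ofReal_lt_top ENNReal.ofReal_lt_top) ?_
    exact lt_of_le_of_lt (lintegral_mono_set hPBsub) hgradfin
  -- (4) `q ∈ L_{3/2}(Q)`
  have hqfin : ∫⁻ z in SereginSverak2009.parCyl 0 1, ‖q z.1 z.2‖ₑ ^ (3 / 2 : ℝ) < ∞ := by
    refine lt_of_le_of_lt (lintegral_mono_set hparsub) ?_
    rw [hq, setLIntegral_enorm_rpow_stRescale hβ hl T (b • eZ) (α ^ 2) p _ (by norm_num),
      finrank_euclideanSpace_fin]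
    refine ENNReal.mul_lt_top (ENNReal.mul_lt_top
      (ENNReal.rpow_lt_top_of_nonneg (by norm_num) enorm_ne_top) ENNReal.ofReal_lt_top) ?_
    exact lt_of_le_of_lt (lintegral_mono_set hPBsub) hpresfin
  -- (5) axisymmetry of the rescaled slices (`b e₃` is fixed by the rotations, which are linear)
  have hvax : ∀ s ∈ Ioo (-1 : ℝ) 0, IsAxisymmetric (v s) := fun s hs => by
    rw [hvs s]; exact SereginSverak2009.isAxisymmetric_rescale (hax _ (htime0 s hs)) α b l
  have hqax : ∀ s ∈ Ioo (-1 : ℝ) 0, IsAxisymmetricScalar (q s) := by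
    intro s hs θ y
    show α ^ 2 • p (T + β * s) (b • eZ + l • rotZ θ y) = α ^ 2 • p (T + β * s) (b • eZ + l • y)
    rw [← SereginSverak2009.rotZ_smul_eZ_add_smul, hpax _ (htime0 s hs) θ]
  -- (6) the swirl bound: `Γ_v(s, y) = ν⁻¹ Γ_u(Φ(s, y))` and `|log (λ r)| ≥ log (e/r)`
  have hswirl : ∃ C₁ : ℝ, ∀ s ∈ Ioo (-1 : ℝ) 0, ∀ y ∈ SereginSverak2009.spaceCyl 0 1,
      0 < cylRadius y → |swirl (v s) y| ≤ C₁ / Real.log (Real.exp 1 / cylRadius y) ^ 3 := by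
    refine ⟨max C 0 / ν, fun s hs y hy hry => ?_⟩
    rw [hvs s, swirl_smul_comp_eZ_smul (u (T + β * s)) α b hl.ne' y]
    have hαl : α / l = ν⁻¹ := by
      rw [hαdef, div_div, mul_comm ν l, ← div_div, div_self hl.ne', one_div]
    rw [hαl, abs_mul, abs_of_pos (inv_pos.2 hν)]
    rw [SereginSverak2009.mem_spaceCyl] at hy
    have hr1 : cylRadius y < 1 := by simpa using hy.1
    have hcx : cylRadius (b • eZ + l • y) = l * cylRadius y := by
      rw [SereginSverak2009.cylRadius_smul_eZ_add, cylRadius_smul, abs_of_pos hl]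
    have hlr : l * cylRadius y ≤ δ₀ := by nlinarith
    have ht : T + β * s ∈ Ico t₀ T := ⟨(htime s hs).1.le, (htime s hs).2⟩
    have hbound := hΓ _ ht (b • eZ + l • y) (by rw [hcx]; exact hlr)
    rw [hcx] at hbound
    obtain ⟨hLpos, hLle⟩ := log_exp_one_div_le_abs_log_mul hl hle hry hr1
    have hL3 : Real.log (Real.exp 1 / cylRadius y) ^ 3 ≤ |Real.log (l * cylRadius y)| ^ 3 :=
      pow_le_pow_left₀ hLpos.le hLle 3
    have h1 : |swirl (u (T + β * s)) (b • eZ + l • y)| ≤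
        max C 0 / Real.log (Real.exp 1 / cylRadius y) ^ 3 :=
      calc |swirl (u (T + β * s)) (b • eZ + l • y)| ≤ C / |Real.log (l * cylRadius y)| ^ 3 := hbound
        _ ≤ max C 0 / |Real.log (l * cylRadius y)| ^ 3 :=
          div_le_div_of_nonneg_right (le_max_left _ _) (by positivity)
        _ ≤ max C 0 / Real.log (Real.exp 1 / cylRadius y) ^ 3 :=
          div_le_div_of_nonneg_left (le_max_right _ _) (pow_pos hLpos 3) hL3
    calc ν⁻¹ * |swirl (u (T + β * s)) (b • eZ + l • y)|
        ≤ ν⁻¹ * (max C 0 / Real.log (Real.exp 1 / cylRadius y) ^ 3) :=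
          mul_le_mul_of_nonneg_left h1 (inv_nonneg.2 hν.le)
      _ = max C 0 / ν / Real.log (Real.exp 1 / cylRadius y) ^ 3 := by
          rw [div_div, mul_comm ν, ← div_div, div_eq_inv_mul _ ν]
  -- (7) the criterion: `v` is essentially bounded near the vertex; transport back to `u`
  obtain ⟨r, hr, hbd⟩ := hloc v q hsuitv hA ⟨G, hGv, hGfin⟩ hqfin hvax hqax hswirl
  have hbd' : eLpNorm (uncurry v) ∞ (volume.restrict (parabolicCylinder r 0)) < ∞ :=
    lt_of_le_of_lt (eLpNorm_mono_measure _
      (Measure.restrict_mono_set _ (parabolicCylinder_subset_parCyl 0 r))) hbd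
  exact isBoundedNearTop_of_eLpNorm_rescaled_lt_top hT hsm.continuousOn (b • eZ) hα hβ hl hr hbd'

end Summit.NavierStokesRegularity.NavierStokesRegularity.Theorems.AxisymmetricKatoGlobal.Registered

end
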